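import Summits.AtomisticToContinuum.HydrodynamicLimit.Theses.JParityClosure
import Summits.AtomisticToContinuum.HydrodynamicLimit.Theses.InformationPercolationEngine
import Summits.AtomisticToContinuum.HydrodynamicLimit.Theses.TwoClocks
import Summits.AtomisticToContinuum.HydrodynamicLimit.Theses.LimitCollisionMeasure
import Summits.AtomisticToContinuum.HydrodynamicLimit.Theorems.InformationPercolationEngineChaosClosesEulerEnskogIdentity
import Summits.AtomisticToContinuum.HydrodynamicLimit.Theorems.InformationPercolationEngineChaosClosesEulerCollisionMomentUI
import Summits.AtomisticToContinuum.HydrodynamicLimit.Theorems.InformationPercolationEngineChaosClosesEulerReadout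
import Summits.AtomisticToContinuum.HydrodynamicLimit.Theorems.InformationPercolationEngineChaosClosesEulerMassBalanceC1
import Summits.AtomisticToContinuum.HydrodynamicLimit.Theorems.InformationPercolationEngineChaosClosesEulerWeakEquation
import Summits.AtomisticToContinuum.HydrodynamicLimit.Theorems.InformationPercolationEngineChaosClosesEulerInitialLayer
import Summits.AtomisticToContinuum.HydrodynamicLimit.Theorems.InformationPercolationEngineChaosClosesEulerBF18Shell
import Summits.AtomisticToContinuum.HydrodynamicLimit.Theorems.InformationPercolationEngineChaosClosesEulerKineticReduction
import Summits.AtomisticToContinuum.HydrodynamicLimit.Theorems.JParityClosureParityBandClosurePressureValueOfEvenStress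
import Summits.AtomisticToContinuum.HydrodynamicLimit.Theorems.JParityClosureParityBandClosureInverseCollisionInvariance
import Summits.AtomisticToContinuum.HydrodynamicLimit.Theorems.JParityClosureParityBandClosureDetailedBalanceOfSymmetricRecord
import Summits.AtomisticToContinuum.HydrodynamicLimit.Theorems.JParityClosureParityBandClosureProductionZeroOfDetailedBalance
import Summits.AtomisticToContinuum.HydrodynamicLimit.Theorems.JParityClosureParityBandClosureIsotropyOfVanishingProduction
import Summits.AtomisticToContinuum.HydrodynamicLimit.Theorems.JParityClosureParityBandClosureIsotropyOfDiracOrMaxwellian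
import Summits.AtomisticToContinuum.HydrodynamicLimit.Theorems.ParityBandClosure.Negative.YoungMixingObstruction
import HarnessLib

/-!
# v1 DESIGN (superseded by v2; kept for the record — card §A4). Line `transfer-weighted-parity-chain`, crux ParityBandClosure (17608).
Fixed-χ space–time-mollified restatements (R-t / R-b₂), the ESE-trace domination lever `TransferRecordDominated`, and the asymptotic
rigidity with a possibly singular record `LocalLawParityRigidity` over Mathlib Kernels. Abandoned because of the DIAGONAL obstruction (card §A3):
its `stub_kineticHalf` would still have to convert χ-averaged identities at scale r into a scale-r conclusion. lean rc 0 when generated.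
-/

noncomputable section

namespace Summit.AtomisticToContinuum.HydrodynamicLimit.Cruxes.ParityBandClosure.TransferWeightedParityChainV1

open scoped BigOperators Topology Classical MeasureTheory ENNReal InnerProductSpace
open Filter Set MeasureTheory
open Literature.MathematicalPhysics.KineticTheory
open Literature.Analysis.FluidPDE
open Summit.AtomisticToContinuum.HydrodynamicLimit.Theses

def WeakStressIsotropyInBand : Prop :=
  ∃ η₀ : ℝ, 0 < η₀ ∧ ∀ (a₀ θ₀ : T3 → ℝ) (u₀ : T3 → V3), Continuous a₀ → Continuous θ₀ → Continuous u₀ →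
    (∀ x, 0 < a₀ x) → (∀ x, 0 < θ₀ x) → ∃ σ₀ : ℝ, 0 < σ₀ ∧ ∀ σ : ℝ, 0 < σ → σ < σ₀ →
    ∀ (T : ℝ) (ρ θ : ℝ → T3 → ℝ) (u : ℝ → T3 → V3), IsHardSphereEulerSolution σ T ρ u θ →
    ∀ Φ : (N : ℕ) → HardSphereFlow (Torus.geometry (Fin 3)) (hsDiameter σ N) (N + 1),
    TendstoHydroFieldsAt (fun N => localGibbsLaw σ a₀ u₀ θ₀ N (Φ N)) Φ ρ u θ 0 →
    ∀ t ∈ Set.Ico 0 T, ∀ a : Fin 3 → Fin 3 → ℝ × T3 → ℝ, (∀ j k, Continuous (a j k)) →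
    (∀ p, ∑ j : Fin 3, a j j p = 0) →
    ∀ g : ℝ → ℝ, Continuous g → (∀ b, η₀ ≤ b → g b = 0) →
    ∀ η δ : ℝ, 0 < η → 0 < δ → ∃ r₀ : ℝ, 0 < r₀ ∧ ∀ r : ℝ, 0 < r → r < r₀ → ∃ N₀ : ℕ, ∀ N : ℕ, N₀ ≤ N →
    let bx : T3 → T3 → ℝ := fun y x => 3 / (Real.pi * r ^ 3) * max (1 - Torus.euclidDist y x / r) 0
    let ρm : Config (N + 1) (Fin 3) T3 → T3 → ℝ := fun w x₀ => ∫ q, bx q.1 x₀ ∂(empiricalMeasure w)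
    let mm : Config (N + 1) (Fin 3) T3 → T3 → V3 := fun w x₀ => ∫ q, bx q.1 x₀ • q.2 ∂(empiricalMeasure w)
    let Pm : Config (N + 1) (Fin 3) T3 → T3 → Fin 3 → Fin 3 → ℝ := fun w x₀ j k =>
      (∫ q, bx q.1 x₀ * (q.2 j * q.2 k) ∂(empiricalMeasure w)) - mm w x₀ j * mm w x₀ k / ρm w x₀
    localGibbsLaw σ a₀ u₀ θ₀ N (Φ N)
      {z | η < |∫ s in Set.Icc 0 t, ∫ x, g (σ ^ 3 * ρm ((Φ N).flow s z) x) *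
        ∑ j : Fin 3, ∑ k : Fin 3, a j k (s, x) * Pm ((Φ N).flow s z) x j k|} ≤ ENNReal.ofReal δ

/-- ESE-trace domination of the transfer-weighted record (the idea's lever, v1). -/
def TransferRecordDominated : Prop :=
  ∃ η₀ : ℝ, 0 < η₀ ∧ ∀ (a₀ θ₀ : Literature.MathematicalPhysics.KineticTheory.T3 → ℝ) (u₀ : Literature.MathematicalPhysics.KineticTheory.T3 → Literature.MathematicalPhysics.KineticTheory.V3), Continuous a₀ → Continuous θ₀ → Continuous u₀ → (∀ x, 0 < a₀ x) → (∀ x, 0 < θ₀ x) → ∃ σ₀ : ℝ, 0 < σ₀ ∧ ∀ σ : ℝ, 0 < σ → σ < σ₀ → ∀ Φ : (N : ℕ) → Literature.Analysis.FluidPDE.HardSphereFlow (Literature.Analysis.FluidPDE.Torus.geometry (Fin 3)) (Literature.MathematicalPhysics.KineticTheory.hsDiameter σ N) (N + 1), ∀ τ : ℝ, 0 < τ → ∀ χ : ℝ × UnitAddTorus (Fin 3) → ℝ, Continuous χ → (∀ p, 0 ≤ χ p) → ∀ g : ℝ → ℝ, Continuous g → (∀ a, η₀ ≤ a → g a = 0)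 → (∀ a, 0 ≤ g a) → ∀ η δ : ℝ, 0 < η → 0 < δ → ∃ r₀ : ℝ, 0 < r₀ ∧ ∀ r : ℝ, 0 < r → r < r₀ → ∃ N₀ : ℕ, ∀ N : ℕ, N₀ ≤ N → let ε := Literature.MathematicalPhysics.KineticTheory.hsDiameter σ N; let G := Literature.Analysis.FluidPDE.Torus.geometry (Fin 3); let γ := fun z (s : ℝ) => (Φ N).flow s z; let bx : UnitAddTorus (Fin 3) → UnitAddTorus (Fin 3) → ℝ := fun x y => 3 / (Real.pi * r ^ 3) * max (1 - Literature.Analysis.FluidPDE.Torus.euclidDist x y / r) 0; let ρm := fun z s (x₀ : UnitAddTorus (Fin 3)) => ∫ q, bx q.1 x₀ ∂(Literature.Analysis.FluidPDE.empiricalMeasure (γ z s)); let em := fun z s (x₀ : UnitAddTorus (Fin 3)) => ∫ q, bx q.1 x₀ * (‖q.2‖ ^ 2 / 2) ∂(Literature.Analysis.FluidPDE.empiricalMeasure (γ z s)); let pv := fun z s (i j : Fin (N + 1)) => Literature.Analysis.FluidPDE.reflectVel (G.sepVec (γ z s i).1 (γ z s j).1) ((γ z s i).2, (γ z s j).2);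 let Kc := fun (Fn : Literature.Analysis.FluidPDE.Config (N + 1) (Fin 3) Literature.MathematicalPhysics.KineticTheory.T3 → ℝ → Fin (N + 1) → Fin (N + 1) → ℝ) z => ε / (N + 1 : ℝ) * ∑ᶠ (s : ℝ) (_ : s ∈ Literature.Analysis.FluidPDE.collisionTimes G ε (γ z) ∩ Set.Icc 0 τ), ∑ i : Fin (N + 1), ∑ j : Fin (N + 1), (if i ≠ j ∧ ‖G.sepVec (γ z s i).1 (γ z s j).1‖ = ε then Fn z s i j else 0); let Y : ℝ → ℝ := fun a => 3 / (2 * Real.pi) * deriv Literature.MathematicalPhysics.KineticTheory.hsExcessFreeEnergy a; let KT := fun z => Kc (fun z s i j => χ (s, (γ z s i).1) * g (σ ^ 3 * ρm z s (γ z s i).1) * max ⟪(pv z s i j).2 - (pv z s i j).1, ε⁻¹ • G.sepVec (γ z s i).1 (γ z s j).1⟫_ℝ 0) z; let R := fun z => σ ^ 3 * ∫ s in Set.Icc (0 : ℝ) τ, ∫ x : UnitAddTorus (Fin 3), χ (s, x) * g (σ ^ 3 * ρm z s x) * |Y (σ ^ 3 * ρm z s x)| * (16 * Real.pi / 3 *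 (ρm z s x * em z s x)); Literature.MathematicalPhysics.KineticTheory.localGibbsLaw σ a₀ u₀ θ₀ N (Φ N) {z | R z + η < KT z} ≤ ENNReal.ofReal δ

/-- 17722 with the KDE mollified in space AND time (R-t, fixed χ). -/
def OddContactSymmetryST : Prop :=
  ∃ η₀ : ℝ, 0 < η₀ ∧ ∀ (a₀ θ₀ : Literature.MathematicalPhysics.KineticTheory.T3 → ℝ) (u₀ : Literature.MathematicalPhysics.KineticTheory.T3 → Literature.MathematicalPhysics.KineticTheory.V3), Continuous a₀ → Continuous θ₀ → Continuous u₀ → (∀ x, 0 < a₀ x) → (∀ x, 0 < θ₀ x) → ∃ σ₀ : ℝ, 0 < σ₀ ∧ ∀ σ : ℝ, 0 < σ → σ < σ₀ → ∀ (T : ℝ) (ρ θ : ℝ → Literature.MathematicalPhysics.KineticTheory.T3 → ℝ) (u : ℝ → Literature.MathematicalPhysics.KineticTheory.T3 → Literature.MathematicalPhysics.KineticTheory.V3), Literature.MathematicalPhysics.KineticTheory.IsHardSphereEulerSolution σ T ρ u θ → ∀ Φ : (N : ℕ) → Literature.Analysis.FluidPDE.HardSphereFlow (Literature.Analysis.FluidPDE.Torus.geometry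 (Fin 3)) (Literature.MathematicalPhysics.KineticTheory.hsDiameter σ N) (N + 1), Literature.MathematicalPhysics.KineticTheory.TendstoHydroFieldsAt (fun N => Literature.MathematicalPhysics.KineticTheory.localGibbsLaw σ a₀ u₀ θ₀ N (Φ N)) Φ ρ u θ 0 → ∀ τ : ℝ, 0 < τ → τ < T → ∀ χ : ℝ × UnitAddTorus (Fin 3) → ℝ, Continuous χ → ∀ g : ℝ → ℝ, Continuous g → (∀ a, η₀ ≤ a → g a = 0) → ∀ Ψ : EuclideanSpace ℝ (Fin 3) × EuclideanSpace ℝ (Fin 3) × EuclideanSpace ℝ (Fin 3) → ℝ, Continuous Ψ → (∃ C : ℝ, ∀ q, |Ψ q| ≤ C) → (∀ (n v w : EuclideanSpace ℝ (Fin 3)), ‖n‖ = 1 → Ψ (-n, (Literature.Analysis.FluidPDE.reflectVel n (v, w)).1, (Literature.Analysis.FluidPDE.reflectVel n (v, w)).2) = -Ψ (n, v, w)) → ∀ η δ : ℝ, 0 < η → 0 < δ → ∃ r₀ : ℝ, 0 < r₀ ∧ ∀ r ϑ : ℝ, 0 < r → r < r₀ → 0 < ϑ → ϑ < r₀ → ∃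 N₀ : ℕ, ∀ N : ℕ, N₀ ≤ N → let ε := Literature.MathematicalPhysics.KineticTheory.hsDiameter σ N; let G := Literature.Analysis.FluidPDE.Torus.geometry (Fin 3); let γ := fun z (s : ℝ) => (Φ N).flow s z; let bx : UnitAddTorus (Fin 3) → UnitAddTorus (Fin 3) → ℝ := fun x y => 3 / (Real.pi * r ^ 3) * max (1 - Literature.Analysis.FluidPDE.Torus.euclidDist x y / r) 0; let ρm := fun z s (x₀ : UnitAddTorus (Fin 3)) => ∫ q, bx q.1 x₀ ∂(Literature.Analysis.FluidPDE.empiricalMeasure (γ z s)); let hm := fun z s (x₀ : UnitAddTorus (Fin 3)) (v : EuclideanSpace ℝ (Fin 3)) => ∫ q, bx q.1 x₀ * Literature.Analysis.FluidPDE.localMaxwellian 1 (ϑ ^ 2) v q.2 ∂(Literature.Analysis.FluidPDE.empiricalMeasure (γ z s)); let pv := fun z s (i j : Fin (N + 1)) => Literature.Analysis.FluidPDE.reflectVel (G.sepVec (γ z s i).1 (γ z s j).1) ((γ z s i).2, (γ z s j).2); let hmT := fun z s (x₀ : UnitAddTorus (Fin 3)) (v : EuclideanSpace ℝ (Fin 3))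 => ∫ s' in Set.Icc (s - r) (s + r), r⁻¹ * max (1 - |s' - s| / r) 0 * hm z s' x₀ v; let F := fun z s (i j : Fin (N + 1)) => Real.log (hmT z s (γ z s i).1 (pv z s i j).1) + Real.log (hmT z s (γ z s i).1 (pv z s i j).2) - Real.log (hmT z s (γ z s i).1 (γ z s i).2) - Real.log (hmT z s (γ z s i).1 (γ z s j).2); let Kc := fun (Fn : Literature.Analysis.FluidPDE.Config (N + 1) (Fin 3) Literature.MathematicalPhysics.KineticTheory.T3 → ℝ → Fin (N + 1) → Fin (N + 1) → ℝ) z => ε / (N + 1 : ℝ) * ∑ᶠ (s : ℝ) (_ : s ∈ Literature.Analysis.FluidPDE.collisionTimes G ε (γ z) ∩ Set.Icc 0 τ), ∑ i : Fin (N + 1), ∑ j : Fin (N + 1), (if i ≠ j ∧ ‖G.sepVec (γ z s i).1 (γ z s j).1‖ = ε then Fn z s i j else 0); let D := fun z => Kc (fun z s i j => χ (s, (γ z s i).1) * g (σ ^ 3 * ρm z s (γ z s i).1) * (Ψ (ε⁻¹ • G.sepVec (γ z s i).1 (γ z s j).1, (pv z s i j).1, (pv z s i j).2) * min 1 (Real.exp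 (-F z s i j)))) z; Literature.MathematicalPhysics.KineticTheory.localGibbsLaw σ a₀ u₀ θ₀ N (Φ N) {z | η < |D z|} ≤ ENNReal.ofReal δ

/-- 13080 with products after space–time windowing (R-b₂, fixed χ). -/
def RateFloorST : Prop :=
  ∃ g₀ : ℝ, 0 < g₀ ∧ ∀ (a₀ θ₀ : Literature.MathematicalPhysics.KineticTheory.T3 → ℝ) (u₀ : Literature.MathematicalPhysics.KineticTheory.T3 → Literature.MathematicalPhysics.KineticTheory.V3), Continuous a₀ → Continuous θ₀ → Continuous u₀ → (∀ x, 0 < a₀ x) → (∀ x, 0 < θ₀ x) → ∃ σ₀ : ℝ, 0 < σ₀ ∧ ∀ σ : ℝ, 0 < σ → σ < σ₀ → ∀ Φ : (N : ℕ) → Literature.Analysis.FluidPDE.HardSphereFlow (Literature.Analysis.FluidPDE.Torus.geometry (Fin 3)) (Literature.MathematicalPhysics.KineticTheory.hsDiameter σ N) (N + 1), ∀ τ : ℝ, 0 < τ → ∀ χ : ℝ × UnitAddTorus (Fin 3) → ℝ, Continuous χ → (∀ p, 0 ≤ χ p) → ∀ Ξ : EuclideanSpace ℝ (Fin 3) ×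 EuclideanSpace ℝ (Fin 3) × EuclideanSpace ℝ (Fin 3) → ℝ, Continuous Ξ → (∀ q, 0 ≤ Ξ q) → (∃ C : ℝ, ∀ q, Ξ q ≤ C) → ∀ η δ : ℝ, 0 < η → 0 < δ → ∃ r₀ : ℝ, 0 < r₀ ∧ ∀ r : ℝ, 0 < r → r < r₀ → ∃ N₀ : ℕ, ∀ N : ℕ, N₀ ≤ N → let ε := Literature.MathematicalPhysics.KineticTheory.hsDiameter σ N; let G := Literature.Analysis.FluidPDE.Torus.geometry (Fin 3); let γ := fun z (s : ℝ) => (Φ N).flow s z; let bx : UnitAddTorus (Fin 3) → UnitAddTorus (Fin 3) → ℝ := fun x y => 3 / (Real.pi * r ^ 3) * max (1 - Literature.Analysis.FluidPDE.Torus.euclidDist x y / r) 0; let Θ := fun (Ξ : EuclideanSpace ℝ (Fin 3) × EuclideanSpace ℝ (Fin 3) × EuclideanSpace ℝ (Fin 3) → ℝ) (v w : EuclideanSpace ℝ (Fin 3)) => ∫ ω : Metric.sphere (0 : EuclideanSpace ℝ (Fin 3)) 1, Ξ ((ω : EuclideanSpace ℝ (Fin 3)), v, w) * Literature.MathematicalPhysics.KineticTheory.hardSphereKernel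 (w, v) ω ∂Literature.MathematicalPhysics.KineticTheory.sphereMeasure; let B := fun Ξ z s (x₀ : UnitAddTorus (Fin 3)) => ∫ s₁ in Set.Icc (s - r) (s + r), ∫ s₂ in Set.Icc (s - r) (s + r), (r⁻¹ * max (1 - |s₁ - s| / r) 0) * (r⁻¹ * max (1 - |s₂ - s| / r) 0) * ∫ p, bx p.1.1 x₀ * bx p.2.1 x₀ * Θ Ξ p.1.2 p.2.2 ∂((Literature.Analysis.FluidPDE.empiricalMeasure (γ z s₁)).prod (Literature.Analysis.FluidPDE.empiricalMeasure (γ z s₂))); let pv := fun z s (i j : Fin (N + 1)) => Literature.Analysis.FluidPDE.reflectVel (G.sepVec (γ z s i).1 (γ z s j).1) ((γ z s i).2, (γ z s j).2); let Kc := fun (Fn : Literature.Analysis.FluidPDE.Config (N + 1) (Fin 3) Literature.MathematicalPhysics.KineticTheory.T3 → ℝ → Fin (N + 1) → Fin (N + 1) → ℝ) z => ε / (N + 1 : ℝ) * ∑ᶠ (s : ℝ) (_ : s ∈ Literature.Analysis.FluidPDE.collisionTimes G ε (γ z) ∩ Set.Icc 0 τ), ∑ i : Fin (N + 1), ∑ j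 : Fin (N + 1), (if i ≠ j ∧ ‖G.sepVec (γ z s i).1 (γ z s j).1‖ = ε then Fn z s i j else 0); Literature.MathematicalPhysics.KineticTheory.localGibbsLaw σ a₀ u₀ θ₀ N (Φ N) {z | Kc (fun z s i j => χ (s, (γ z s i).1) * Ξ (ε⁻¹ • G.sepVec (γ z s i).1 (γ z s j).1, (pv z s i j).1, (pv z s i j).2)) z < g₀ * σ ^ 3 * (∫ s in Set.Icc (0 : ℝ) τ, ∫ x : UnitAddTorus (Fin 3), χ (s, x) * B Ξ z s x) - η} ≤ ENNReal.ofReal δ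

/-- Asymptotic parity rigidity with a possibly singular record (v1 residual). -/
def LocalLawParityRigidity : Prop :=
  ∀ (X : Type) [MeasurableSpace X] (μX : Measure X) [IsFiniteMeasure μX]
    (m : ProbabilityTheory.Kernel X V3) [ProbabilityTheory.IsMarkovKernel m]
    (κ : ProbabilityTheory.Kernel X ((V3 × V3) × Metric.sphere (0 : V3) 1)) [ProbabilityTheory.IsFiniteKernel κ]
    (ϑs : ℕ → ℝ), (∀ n, 0 < ϑs n) → Tendsto ϑs atTop (𝓝 0) →
    (∀ᵐ x ∂μX, Integrable (fun v : V3 => ‖v‖ ^ 2) (m x)) →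
    (∀ᵐ x ∂μX, Integrable (fun q : (V3 × V3) × Metric.sphere (0 : V3) 1 => ‖q.1.1‖ ^ 4 + ‖q.1.2‖ ^ 4) (κ x)) →
    let J : (V3 × V3) × Metric.sphere (0 : V3) 1 → (V3 × V3) × Metric.sphere (0 : V3) 1 :=
      fun q => (collide q.2 q.1, -q.2)
    let h : Measure V3 → ℝ → V3 → ℝ := fun μ ϑ v => ∫ v', localMaxwellian 1 (ϑ ^ 2) v v' ∂μ
    let F : Measure V3 → ℝ → (V3 × V3) × Metric.sphere (0 : V3) 1 → ℝ := fun μ ϑ q =>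
      Real.log (h μ ϑ q.1.1) + Real.log (h μ ϑ q.1.2) -
        Real.log (h μ ϑ (collide q.2 q.1).1) - Real.log (h μ ϑ (collide q.2 q.1).2)
    (∀ᵐ x ∂μX, ∀ c : V3 → ℝ, Continuous c → (∃ C : ℝ, ∀ v, |c v| ≤ C) →
      ∫ q, (c (collide q.2 q.1).1 + c (collide q.2 q.1).2 - c q.1.1 - c q.1.2) ∂(κ x) = 0) →
    (∀ᵐ x ∂μX, ∃ c₀ : ℝ, 0 < c₀ ∧
      (((m x : Measure V3).prod (m x : Measure V3)).prod sphereMeasure).withDensity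
          (fun q => ENNReal.ofReal (c₀ * hardSphereKernel (q.1.2, q.1.1) q.2)) ≤ (κ x)) →
    (∀ Ψ : (V3 × V3) × Metric.sphere (0 : V3) 1 → ℝ, Continuous Ψ → (∃ C : ℝ, ∀ q, |Ψ q| ≤ C) →
      (∀ q, Ψ (J q) = -Ψ q) →
      ∀ ψ : X → ℝ, Measurable ψ → (∃ C : ℝ, ∀ x, |ψ x| ≤ C) →
      Tendsto (fun n : ℕ => ∫ x, ψ x * ∫ q, Ψ q * min (hardSphereKernel (q.1.2, q.1.1) q.2) 1 *
          min 1 (Real.exp (-(F (m x) (ϑs n) q))) ∂(κ x) ∂μX) atTop (𝓝 0)) →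
    ∀ᵐ x ∂μX, (∃ u : V3, (m x : Measure V3) = Measure.dirac u) ∨
      (∃ θ : ℝ, ∃ u : V3, 0 < θ ∧
        (m x : Measure V3) = (volume : Measure V3).withDensity fun v => ENNReal.ofReal (localMaxwellian 1 θ u v))

theorem stub_transferDomination : JParityClosure.EvenStressEnskog → TransferRecordDominated := by
  sorry

theorem stub_localLawParityRigidity : LocalLawParityRigidity := by
  sorry

theorem stub_kineticHalf_v1 :
    LocalLawParityRigidity → OddContactSymmetryST → RateFloorST → JParityClosure.DensityCap →
    TransferRecordDominated → TwoClocks.EnergyCurrentTails → LimitCollisionMeasure.CollisionTightness →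
    WeakStressIsotropyInBand := by
  sorry

end Summit.AtomisticToContinuum.HydrodynamicLimit.Cruxes.ParityBandClosure.TransferWeightedParityChainV1

end
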